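import Mathlib.Algebra.Field.ZMod
import Literature.Computability.Cryptography.LWERegevTransforms
import Literature.Computability.Complexity.SamplingDeviationPMF
import Literature.Probability.Distributions.FiniteProductLaws
import HarnessLib

/-!
# Regev's decision-to-search reduction, I: the estimates made for one shift of the secret

Topic `Computability/Cryptography` (LWE), grouping namespace `LWE.RegevReduction`. This is the
probabilistic core of Regev's Lemma 4.2 (Decision to Search) fused with the estimation step of
Lemma 4.1 (Average-case to Worst-case), Regev 2009, §4 (held copy arXiv:2401.03703, p. 23), for
ONE shift `t` of the unknown secret `s` and an ARBITRARY deterministic test `D` on blocks of `m`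
samples (the oracle of `regev_decision_to_search`, `LWEHardness.lean`, is such a test):

* the data of one shift (`Inner`): for each *estimate* `e` — `none`, "accept on shifted samples"
  (Lemma 4.1: `f_t`), or `some (i, k)`, "accept on samples coordinate-tested with the guess `k` for
  `sᵢ`, then shifted" (Lemma 4.2) — `N` fresh *pieces*, a piece being `m` pairs (fresh uniform
  scalar `l`, fresh sample from `A_{s,χ}`); its law `innerLaw` (`piLaw`s of `pieceLaw`);
* `query t e x`, the block fed to `D`; `count` (number of accepting repetitions), `dev i k =
  |count (i,k) - count none|`, `score i₀ = max_k dev i₀ k`, and the candidate secret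
  `cand sel i = sel (dev i ·)` for an abstract minimum selector `sel` (`IsMinSel`);
* the means (`lawOf`, `mean`): by the transformation identities of `LWERegevTransforms.lean` the
  queried block has law `A_{s+t,χ}^m` for `e = none` and for a correct guess, and `U^m` for a wrong
  guess (`pieceLaw_map_query`), so `count e / N` estimates `mean e ∈ {p(s+t), p_U}`
  (`pAcc D (lweSamples χ (s+t) m)`, `pAcc D (uniformSamples …)`);
* **`innerLaw_compl_acc_le`**: all `n q + 1` estimates are simultaneously `η`-accurate
  (`Acc`) except with probability `≤ (n q + 1)/(4 N η²)` (Chebyshev for each estimate,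
  `Literature.Computability.Complexity.pi_measure_not_lt_deviation_le`, and a union bound; Regev
  uses the Chernoff bound here, Chebyshev suffices for inverse-polynomial error);
* the deterministic consequences of accuracy: **`abs_score_sub_lt`** (the score is within `2Nη` of
  `N·gap`, `gap = |p(s+t) - p_U|`, needs `q ≥ 2`) and **`cand_eq_of_acc`** (if `gap ≥ 4η`, every
  minimum selector returns `sᵢ` at every coordinate: "using `W`, we can test whether `k = s₁`").

The outer loop over random shifts (Lemma 4.1 proper) and the averaging argument are in
`LWERegevCore.lean`.

## References

* O. Regev, *On lattices, learning with errors, random linear codes, and cryptography*, J. ACM 56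
  (2009), art. 34, §4, Lemmas 4.1–4.2 and their proofs (held: arXiv:2401.03703, p. 23).
  [cite: RegevLWE2009, §4 Lemma 4.1–4.2]
* E. Kranakis, *Primality and Cryptography*, Wiley–Teubner 1986, Thm. 3.5 (Chebyshev WLLN).
-/

noncomputable section

namespace Literature.Computability.Cryptography

namespace LWE

namespace RegevReduction

open _root_.MeasureTheory Finset Literature.Probability.Distributions
  Literature.Computability.Complexity
open scoped ENNReal

variable {n q m N : ℕ}

/-! ### Data of one shift and the queried blocks -/

/-- A secret / shift vector `s, t ∈ ℤ_qⁿ`. [cite: RegevLWE2009, §2] -/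
abbrev Secret (n q : ℕ) : Type := Fin n → ZMod q

/-- A block of `m` LWE-or-uniform samples `(aⱼ, bⱼ) ∈ ℤ_qⁿ × ℤ_q` (the input of the test `D`).
[cite: RegevLWE2009, §4] -/
abbrev Block (n q m : ℕ) : Type := Fin m → (Fin n → ZMod q) × ZMod q

/-- A *piece* of fresh randomness for one call of the test: `m` pairs (uniform scalar `l`, fresh
sample from the input distribution). [cite: RegevLWE2009, §4 (proof of Lemma 4.2: "l ∈ ℤ_p chosen uniformly at random")] -/
abbrev Piece (n q m : ℕ) : Type := Fin m → ZMod q × ((Fin n → ZMod q) × ZMod q)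

/-- The index of an *estimate* made for one shift: `none` = acceptance on shifted samples
(Lemma 4.1), `some (i, k)` = acceptance on samples coordinate-tested with guess `k` for `sᵢ`
(Lemma 4.2). [cite: RegevLWE2009, §4 Lemma 4.1–4.2] -/
abbrev Est (n q : ℕ) : Type := Option (Fin n × ZMod q)

/-- The data of one shift: `N` fresh pieces for each estimate. [cite: RegevLWE2009, §4 Lemma 4.1–4.2] -/
abbrev Inner (n q m N : ℕ) : Type := Est n q → Fin N → Piece n q m

/-- The block fed to the test for estimate `e` under the shift `t`: shift every sample by `t`
(`e = none`), resp. first apply the coordinate test `(i, k)` with the piece's fresh scalars and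
then shift (`e = some (i, k)`). [cite: RegevLWE2009, §4 (proofs of Lemmas 4.1, 4.2)] -/
def query (t : Secret n q) : Est n q → Piece n q m → Block n q m
  | none => fun x => (fun y => shiftSample t y.2) ∘ x
  | some ik => fun x => (fun y => shiftSample t (coordSample ik.1 ik.2 y.1 y.2)) ∘ x

/-- The acceptance probability of the deterministic test `D` on a block drawn from `P`.
[cite: RegevLWE2009, §4 ("the acceptance probability of W on inputs from …")] -/
def pAcc (D : Block n q m → Bool) (P : PMF (Block n q m)) : ℝ :=
  (P.toOuterMeasure {b | D b = true}).toReal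

/-- `pAcc` is a probability: nonnegative. [folklore] -/
theorem pAcc_nonneg (D : Block n q m → Bool) (P : PMF (Block n q m)) : 0 ≤ pAcc D P :=
  ENNReal.toReal_nonneg

/-- `pAcc` is a probability: at most `1`. [folklore] -/
theorem pAcc_le_one (D : Block n q m → Bool) (P : PMF (Block n q m)) : pAcc D P ≤ 1 := by
  refine ENNReal.toReal_le_of_le_ofReal zero_le_one ?_
  rw [ENNReal.ofReal_one]
  exact (measure_mono (μ := P.toOuterMeasure) (Set.subset_univ _)).trans_eq
    ((PMF.toOuterMeasure_apply_eq_one_iff P Set.univ).2 (Set.subset_univ _))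

/-! ### Counts, deviations, candidate -/

/-- The number of accepting repetitions of estimate `e`. [cite: RegevLWE2009, §4 (proof of Lemma 4.1: "estimate the acceptance probability … by calling W … times")] -/
def count (D : Block n q m → Bool) (t : Secret n q) (ω : Inner n q m N) (e : Est n q) : ℕ :=
  (univ.filter fun r : Fin N => D (query t e (ω e r)) = true).card

/-- The deviation `|count (i, k) - count none|` of the coordinate test `(i, k)` from the plain
shifted estimate (small iff the guess is correct, for a good shift). [cite: RegevLWE2009, §4 (proof of Lemma 4.2)] -/
def dev (D : Block n q m → Bool) (t : Secret n q) (ω : Inner n q m N) (i : Fin n) (k : ZMod q) : ℕ :=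
  ((count D t ω (some (i, k)) : ℤ) - count D t ω none).natAbs

/-- A *minimum selector*: a rule returning, for every `ℕ`-valued function on `ℤ_q`, a point where
it is minimal (e.g. the first minimiser in the order `0, 1, …, q-1`). [folklore] -/
def IsMinSel (sel : (ZMod q → ℕ) → ZMod q) : Prop :=
  ∀ (f : ZMod q → ℕ) (k : ZMod q), f (sel f) ≤ f k

/-- The candidate secret: at each coordinate the guess of least deviation ("since there are only
`p < poly(n)` possibilities for `s₁` we can try all of them"). [cite: RegevLWE2009, §4 (proof of Lemma 4.2)] -/
def cand (D : Block n q m → Bool) (t : Secret n q) (sel : (ZMod q → ℕ) → ZMod q)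
    (ω : Inner n q m N) : Secret n q :=
  fun i => sel fun k => dev D t ω i k

/-- The deviation as a real number: `|count (i,k) - count none|`. [folklore] -/
theorem dev_cast (D : Block n q m → Bool) (t : Secret n q) (ω : Inner n q m N) (i : Fin n)
    (k : ZMod q) :
    (dev D t ω i k : ℝ) = |(count D t ω (some (i, k)) : ℝ) - count D t ω none| := by
  rw [dev, Nat.cast_natAbs, Int.cast_abs, Int.cast_sub, Int.cast_natCast, Int.cast_natCast]

variable [NeZero q]

/-- The score of the shift: the largest deviation at the reference coordinate `i₀` (estimates
`N · |p(s+t) - p_U|`, Lemma 4.1's "if the two estimates differ by more than …"). [cite: RegevLWE2009, §4 (proof of Lemma 4.1)] -/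
def score (D : Block n q m → Bool) (t : Secret n q) (ω : Inner n q m N) (i₀ : Fin n) : ℕ :=
  univ.sup fun k : ZMod q => dev D t ω i₀ k

/-! ### Laws and means -/

/-- The law of the queried block for estimate `e` (shift `t`, true secret `s`): `A_{s+t,χ}^m` for
`none` and for the correct guess `k = sᵢ`, the uniform law `U^m` for a wrong guess.
[cite: RegevLWE2009, §4 (proofs of Lemmas 4.1, 4.2)] -/
def lawOf (χ : PMF (ZMod q)) (s t : Secret n q) (m : ℕ) : Est n q → PMF (Block n q m)
  | none => lweSamples χ (s + t) m
  | some ik => if ik.2 = s ik.1 then lweSamples χ (s + t) m else uniformSamples (Fin n) (ZMod q) m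

/-- The mean of estimate `e`: the acceptance probability of `D` on `lawOf e`.
[cite: RegevLWE2009, §4 Lemma 4.1–4.2] -/
def mean (χ : PMF (ZMod q)) (s t : Secret n q) (D : Block n q m → Bool) (e : Est n q) : ℝ :=
  pAcc D (lawOf χ s t m e)

/-- The *gap* at the shifted secret: `|p(s+t) - p_U|`, the quantity a good shift makes large.
[cite: RegevLWE2009, §4 (proof of Lemma 4.1)] -/
def gap (χ : PMF (ZMod q)) (s t : Secret n q) (D : Block n q m → Bool) : ℝ :=
  |pAcc D (lweSamples χ (s + t) m) - pAcc D (uniformSamples (Fin n) (ZMod q) m)|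

/-- `gap ≥ 0`. [folklore] -/
theorem gap_nonneg (χ : PMF (ZMod q)) (s t : Secret n q) (D : Block n q m → Bool) :
    0 ≤ gap χ s t D :=
  abs_nonneg _

/-- `mean none = p(s+t)`. [folklore] -/
@[simp] theorem mean_none (χ : PMF (ZMod q)) (s t : Secret n q) (D : Block n q m → Bool) :
    mean χ s t D none = pAcc D (lweSamples χ (s + t) m) := rfl

/-- `mean (i, sᵢ) = p(s+t)` (correct guess). [folklore] -/
theorem mean_some_self (χ : PMF (ZMod q)) (s t : Secret n q) (D : Block n q m → Bool) (i : Fin n) :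
    mean χ s t D (some (i, s i)) = pAcc D (lweSamples χ (s + t) m) := by
  simp [mean, lawOf]

/-- `mean (i, k) = p_U` for a wrong guess `k ≠ sᵢ`. [folklore] -/
theorem mean_some_of_ne (χ : PMF (ZMod q)) (s t : Secret n q) (D : Block n q m → Bool) {i : Fin n}
    {k : ZMod q} (hk : k ≠ s i) :
    mean χ s t D (some (i, k)) = pAcc D (uniformSamples (Fin n) (ZMod q) m) := by
  simp [mean, lawOf, hk]

/-- The law of one piece: `m` independent pairs `(l, x)`, `l` uniform in `ℤ_q`, `x ← A_{s,χ}`.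
[cite: RegevLWE2009, §4 (proof of Lemma 4.2)] -/
def pieceLaw (χ : PMF (ZMod q)) (s : Secret n q) (m : ℕ) : PMF (Piece n q m) :=
  iidPMF (pairLaw (lweSample χ s)) m

/-- The law of the data of one shift: all pieces independent. [cite: RegevLWE2009, §4 Lemma 4.1–4.2] -/
def innerLaw (χ : PMF (ZMod q)) (s : Secret n q) (m N : ℕ) : PMF (Inner n q m N) :=
  piLaw fun _ : Est n q => piLaw fun _ : Fin N => pieceLaw χ s m

/-- **The queried block has the law `lawOf e`** (`A_{s+t,χ}^m` or `U^m`; `q` prime for the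
wrong-guess case). [cite: RegevLWE2009, §4 (proofs of Lemmas 4.1, 4.2)] -/
theorem pieceLaw_map_query [Fact q.Prime] (χ : PMF (ZMod q)) (s t : Secret n q) (e : Est n q) :
    (pieceLaw χ s m).map (query t e) = lawOf χ s t m e := by
  cases e with
  | none => exact iidPMF_pairLaw_map_shift_snd χ s t m
  | some ik =>
    obtain ⟨i, k⟩ := ik
    by_cases hk : k = s i
    · subst hk
      simp only [lawOf, if_true]
      exact iidPMF_pairLaw_map_shift_coord_self χ s t i m
    · simp only [lawOf, hk, if_false]
      exact iidPMF_pairLaw_map_shift_coord_of_ne χ s t i hk m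

/-- The probability that the queried block is accepted is `mean e`. [cite: RegevLWE2009, §4 Lemma 4.1–4.2] -/
theorem pieceLaw_real_query [Fact q.Prime] (χ : PMF (ZMod q)) (s t : Secret n q)
    (D : Block n q m → Bool) (e : Est n q) :
    (pieceLaw χ s m).toMeasure.real {x | D (query t e x) = true} = mean χ s t D e := by
  rw [measureReal_def, PMF.toMeasure_apply_eq_toOuterMeasure,
    show {x : Piece n q m | D (query t e x) = true} = query t e ⁻¹' {b | D b = true} from rfl,
    ← PMF.toOuterMeasure_map_apply, pieceLaw_map_query]
  rfl

/-! ### Accuracy of all estimates -/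

/-- The *accuracy event* of one shift: every estimate is within `N η` of `N · mean`.
[cite: RegevLWE2009, §4 (proof of Lemma 4.1: "an estimate that … is within ± … of the true acceptance probabilities")] -/
def Acc (χ : PMF (ZMod q)) (s t : Secret n q) (D : Block n q m → Bool) (N : ℕ) (η : ℝ) :
    Set (Inner n q m N) :=
  {ω | ∀ e : Est n q, |(count D t ω e : ℝ) - N * mean χ s t D e| < N * η}

/-- The number of estimates is `n q + 1`. [folklore] -/
theorem card_est : Fintype.card (Est n q) = n * q + 1 := by
  rw [Fintype.card_option, Fintype.card_prod, Fintype.card_fin, ZMod.card]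

/-- **All estimates of one shift are accurate except with probability `(nq+1)/(4Nη²)`**
(Chebyshev for each of the `nq + 1` estimates and a union bound). [cite: RegevLWE2009, §4 (proof of Lemma 4.1, estimation step)] -/
theorem innerLaw_compl_acc_le [Fact q.Prime] (χ : PMF (ZMod q)) (s t : Secret n q)
    (D : Block n q m → Bool) (hN : 0 < N) {η : ℝ} (hη : 0 < η) :
    (innerLaw χ s m N).toOuterMeasure (Acc χ s t D N η)ᶜ ≤
      ENNReal.ofReal ((n * q + 1) / (4 * N * η ^ 2)) := by
  classical
  set P : PMF (Fin N → Piece n q m) := piLaw fun _ : Fin N => pieceLaw χ s m with hP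
  set Bad : Est n q → Set (Fin N → Piece n q m) := fun e =>
    {ρ | ¬ |((univ.filter fun r : Fin N => D (query t e (ρ r)) = true).card : ℝ) -
      N * mean χ s t D e| < N * η} with hBad
  have hsub : (Acc χ s t D N η)ᶜ ⊆ ⋃ e, (Function.eval e) ⁻¹' Bad e := by
    intro ω hω
    simp only [Acc, Set.mem_compl_iff, Set.mem_setOf_eq, not_forall] at hω
    obtain ⟨e, he⟩ := hω
    exact Set.mem_iUnion.2 ⟨e, he⟩
  have hBad_le : ∀ e, P.toMeasure (Bad e) ≤ ENNReal.ofReal (1 / (4 * N * η ^ 2)) := fun e => by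
    rw [hP, toMeasure_piLaw]
    have h := pi_measure_not_lt_deviation_le (pieceLaw χ s m).toMeasure
      (fun x : Piece n q m => D (query t e x) = true) hN hη
    rwa [pieceLaw_real_query χ s t D e] at h
  rw [innerLaw, toOuterMeasure_piLaw_apply]
  calc Measure.pi (fun _ : Est n q => P.toMeasure) (Acc χ s t D N η)ᶜ
      ≤ Measure.pi (fun _ : Est n q => P.toMeasure) (⋃ e, (Function.eval e) ⁻¹' Bad e) :=
        measure_mono hsub
    _ ≤ ∑ e, Measure.pi (fun _ : Est n q => P.toMeasure) ((Function.eval e) ⁻¹' Bad e) :=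
        measure_iUnion_fintype_le _ _
    _ = ∑ e, P.toMeasure (Bad e) := Finset.sum_congr rfl fun e _ =>
        (measurePreserving_eval (fun _ : Est n q => P.toMeasure) e).measure_preimage
          (Bad e).to_countable.measurableSet.nullMeasurableSet
    _ ≤ ∑ _e : Est n q, ENNReal.ofReal (1 / (4 * N * η ^ 2)) := Finset.sum_le_sum fun e _ => hBad_le e
    _ = ENNReal.ofReal ((n * q + 1) / (4 * N * η ^ 2)) := by
        rw [Finset.sum_const, Finset.card_univ, card_est, nsmul_eq_mul, ← ENNReal.ofReal_natCast,
          ← ENNReal.ofReal_mul (by positivity)]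
        congr 1
        push_cast
        ring

/-! ### Deterministic consequences of accuracy -/

section Deterministic

variable {χ : PMF (ZMod q)} {s t : Secret n q} {D : Block n q m → Bool} {η : ℝ} {ω : Inner n q m N}

omit [NeZero q] in
/-- `||a - b| - |c - d|| ≤ |a - c| + |b - d|`. [folklore] -/
theorem abs_abs_sub_abs_sub_le (a b c d : ℝ) : |(|a - b| - |c - d|)| ≤ |a - c| + |b - d| := by
  calc |(|a - b| - |c - d|)| ≤ |(a - b) - (c - d)| := abs_abs_sub_abs_le_abs_sub _ _
    _ = |(a - c) - (b - d)| := by ring_nf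
    _ ≤ |a - c| + |b - d| := abs_sub _ _

/-- Under accuracy, the deviation of the CORRECT guess is `< 2Nη`. [cite: RegevLWE2009, §4 (proof of Lemma 4.2: "if k = s₁ then this transformation also takes A_{s,χ} to itself")] -/
theorem dev_self_lt (hacc : ω ∈ Acc χ s t D N η) (i : Fin n) :
    (dev D t ω i (s i) : ℝ) < 2 * N * η := by
  have h1 := hacc (some (i, s i))
  have h0 := hacc none
  rw [mean_some_self] at h1
  rw [mean_none] at h0
  rw [dev_cast]
  calc |(count D t ω (some (i, s i)) : ℝ) - count D t ω none|
      ≤ |(count D t ω (some (i, s i)) : ℝ) - N * pAcc D (lweSamples χ (s + t) m)| +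
          |(count D t ω none : ℝ) - N * pAcc D (lweSamples χ (s + t) m)| := by
        simpa only [sub_self, abs_zero, sub_zero, abs_abs] using
          abs_abs_sub_abs_sub_le (count D t ω (some (i, s i)) : ℝ) (count D t ω none)
            (N * pAcc D (lweSamples χ (s + t) m)) (N * pAcc D (lweSamples χ (s + t) m))
    _ < N * η + N * η := add_lt_add h1 h0
    _ = 2 * N * η := by ring

/-- Under accuracy, the deviation of a WRONG guess is within `2Nη` of `N · gap`.
[cite: RegevLWE2009, §4 (proof of Lemma 4.2: "if k ≠ s₁ then it takes A_{s,χ} to the uniform distribution")] -/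
theorem abs_dev_sub_lt_of_ne (hacc : ω ∈ Acc χ s t D N η) {i : Fin n} {k : ZMod q} (hk : k ≠ s i) :
    |(dev D t ω i k : ℝ) - N * gap χ s t D| < 2 * N * η := by
  have h1 := hacc (some (i, k))
  have h0 := hacc none
  rw [mean_some_of_ne χ s t D hk] at h1
  rw [mean_none] at h0
  have hN0 : (0 : ℝ) ≤ N := Nat.cast_nonneg N
  have hNgap : (N : ℝ) * gap χ s t D =
      |N * pAcc D (uniformSamples (Fin n) (ZMod q) m) - N * pAcc D (lweSamples χ (s + t) m)| := by
    rw [gap, ← mul_sub, abs_mul, abs_of_nonneg hN0, abs_sub_comm]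
  rw [dev_cast, hNgap]
  calc |(|(count D t ω (some (i, k)) : ℝ) - count D t ω none| -
        |N * pAcc D (uniformSamples (Fin n) (ZMod q) m) - N * pAcc D (lweSamples χ (s + t) m)|)|
      ≤ |(count D t ω (some (i, k)) : ℝ) - N * pAcc D (uniformSamples (Fin n) (ZMod q) m)| +
          |(count D t ω none : ℝ) - N * pAcc D (lweSamples χ (s + t) m)| :=
        abs_abs_sub_abs_sub_le _ _ _ _
    _ < N * η + N * η := add_lt_add h1 h0
    _ = 2 * N * η := by ring

/-- Under accuracy every deviation is `< N·gap + 2Nη`. [cite: RegevLWE2009, §4 Lemma 4.1–4.2] -/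
theorem dev_lt (hacc : ω ∈ Acc χ s t D N η) (i : Fin n) (k : ZMod q) :
    (dev D t ω i k : ℝ) < N * gap χ s t D + 2 * N * η := by
  by_cases hk : k = s i
  · subst hk
    have hg : 0 ≤ (N : ℝ) * gap χ s t D := mul_nonneg (Nat.cast_nonneg N) (gap_nonneg χ s t D)
    linarith [dev_self_lt hacc i]
  · have h := abs_dev_sub_lt_of_ne hacc hk
    rw [abs_lt] at h
    linarith [h.2]

/-- **Under accuracy the score is within `2Nη` of `N · gap`** (for `q ≥ 2`, so that a wrong guess
exists at the reference coordinate). [cite: RegevLWE2009, §4 (proof of Lemma 4.1: "the two estimates differ by …")] -/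
theorem abs_score_sub_lt [Fact (1 < q)] (hacc : ω ∈ Acc χ s t D N η) (i₀ : Fin n) :
    |(score D t ω i₀ : ℝ) - N * gap χ s t D| < 2 * N * η := by
  rw [abs_lt]
  constructor
  · -- lower bound through a wrong guess `k₁ = s i₀ + 1 ≠ s i₀`
    have hk₁ : s i₀ + 1 ≠ s i₀ := by simp
    have hle : dev D t ω i₀ (s i₀ + 1) ≤ score D t ω i₀ :=
      Finset.le_sup (f := fun k : ZMod q => dev D t ω i₀ k) (Finset.mem_univ (s i₀ + 1))
    have hle' : (dev D t ω i₀ (s i₀ + 1) : ℝ) ≤ score D t ω i₀ := by exact_mod_cast hle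
    have h := abs_dev_sub_lt_of_ne hacc hk₁
    rw [abs_lt] at h
    linarith [h.1]
  · -- upper bound: the score is one of the deviations
    obtain ⟨k₀, -, hk₀⟩ := Finset.exists_mem_eq_sup (univ : Finset (ZMod q)) univ_nonempty
      fun k : ZMod q => dev D t ω i₀ k
    rw [score, hk₀]
    linarith [dev_lt hacc i₀ k₀]

/-- **Under accuracy and a gap `≥ 4η`, every minimum selector finds the secret**: at each
coordinate the correct guess has deviation `< 2Nη`, every wrong one `> 2Nη`.
[cite: RegevLWE2009, §4 (proof of Lemma 4.2: "using W, we can test whether k = s₁")] -/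
theorem cand_eq_of_acc (hacc : ω ∈ Acc χ s t D N η) {sel : (ZMod q → ℕ) → ZMod q}
    (hsel : IsMinSel sel) (hgap : 4 * η ≤ gap χ s t D) : cand D t sel ω = s := by
  funext i
  by_contra hne
  have hmin := hsel (fun k => dev D t ω i k) (s i)
  have hmin' : (dev D t ω i (sel fun k => dev D t ω i k) : ℝ) ≤ dev D t ω i (s i) := by
    exact_mod_cast hmin
  have hself := dev_self_lt hacc i
  have hwrong := abs_dev_sub_lt_of_ne hacc (k := sel fun k => dev D t ω i k) hne
  rw [abs_lt] at hwrong
  have hN0 : (0 : ℝ) ≤ N := Nat.cast_nonneg N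
  have h4 : (N : ℝ) * (4 * η) ≤ N * gap χ s t D := mul_le_mul_of_nonneg_left hgap hN0
  linarith [hwrong.1]

end Deterministic

end RegevReduction

end LWE

end Literature.Computability.Cryptography

end
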